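import Mathlib
import Summits.MatrixMultiplication.MatrixMultiplication.Theses.SnSubsetDichotomy
import Literature.RepresentationTheory.FiniteGroups.KLRGradedCellularBasis
import Literature.Barriers.MatrixMultiplication.NilpotentGroupBarrierSemisimple
import Summits.MatrixMultiplication.MatrixMultiplication.Theorems.SnSubsetDichotomyNoThresholdSubsetTripleStubGradedCodim
import Summits.MatrixMultiplication.MatrixMultiplication.Theorems.SnSubsetDichotomyNoThresholdSubsetTripleStubSavingTransfer
import Summits.MatrixMultiplication.MatrixMultiplication.Theorems.SnSubsetDichotomyNoThresholdSubsetTripleDegreeTailSingleOfMDP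

/-!
# `SnSubsetDichotomy.NoThresholdSubsetTriple`, line `klr-graded-polynomial-method`:
# stub `noThresholdSubsetTriple_of_klr_swPairsMDP` (the whole line as one conditional theorem)

The KLR graded polynomial method for TPP subset triples of `S_n`, assembled from its two
inputs to the crux BY NAME:

* **K3** (hypothesis) — the named Literature fact `KLRGradedCellularBasis`
  (Brundan–Kleshchev 2009, Hu–Mathas 2010, Brundan–Kleshchev–Wang 2011): for every prime `p`,
  `𝔽_p[S_n]` has a basis indexed by `TableauPair n` (same-shape pairs `(μ, S, T)` of standard
  tableaux), multiplicative in (`p`-content, `deg_p S + deg_p T`);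
* **J′** (hypothesis, the line's open statement) — the moderate deviation of the parity-signed
  south-west / north-east pair count of the second tableau on the `3√n`-box:
  `#{(μ, S, T) : μ₁, ℓ(μ) < 3√n, 200·(S⁺(T) − S⁻(T)) ≤ −n} ≤ n!·e^{-c√n}` for large `n`.

Conclusion: `NoThresholdSubsetTriple` — every TPP triple `S, T, U ⊆ S_n` has
`|S||T||U| ≤ (n!)^{3/2} e^{-c'√n}` for large `n`.

Proof (bookkeeping over three LANDED tree theorems).
1. `degreeTailSingle_of_swPairsMDP hJ` (K2′): with `w = c₀ − (c₀ − c₁)²` the `2`-block weight of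
   the shape, the pairs whose SECOND tableau has BKW `2`-degree outside the middle third of
   `[0, w]` (`3·deg₂ T ≤ w ∨ 2w ≤ 3·deg₂ T`, "`T` bad") number `≤ n!e^{-c√n}`.
2. K2 (here, `two_mul_card_add_card_le`): with the block-dependent cut `a = ⌈2w/3⌉ = ⌊(2w+2)/3⌋`,
   `2·#{deg S + deg T < a} + #{2a ≤ deg S + deg T} ≤ 6·#{T bad}` — by pigeonhole a pair counted
   on either side has `S` bad or `T` bad, `#{S bad ∨ T bad} ≤ #{S bad} + #{T bad}`, and the swap
   involution `(μ, S, T) ↦ (μ, T, S)` gives `#{S bad} = #{T bad}`.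
3. `stub_gradedCodim` (K1, BCCGU 2017 Prop. 3.2 for `ℤ`-graded block bases) applied to the K3
   basis of `𝔽₂[S_n]` with this cut: `slice-rank_{𝔽₂} D_{S_n} ≤ 2·#{deg < a} + #{2a ≤ deg}`;
   hence `slice-rank_{𝔽₂} D_{S_n} ≤ 6·n!e^{-c√n} ≤ n!e^{-(c/2)√n}` once `6 ≤ e^{(c/2)√n}`
   (the modular slice-rank saving, prime `p = 2`).
4. `stub_savingTransfer` (packing + `⟨N,N,N⟩` realisation + `N² ≤ slice-rank`, BCCGU 2017 §6 and
   Prop. B.6): the saving implies `NoThresholdSubsetTriple`.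
-/

namespace Summit.MatrixMultiplication.MatrixMultiplication.Theorems

open Literature.RepresentationTheory.FiniteGroups (TableauPair KLRGradedCellularBasis residueContent tableauDegree)
open Literature.NumberTheory.DiophantineGeometry (StdFilling)
open Literature.Barriers.MatrixMultiplication (sliceRank mulGroupTensor)
open scoped BigOperators

namespace KlrLine

/-- **The counting step K2′ ⟹ K2** on a finite index type with an involution-like symmetry `e`
exchanging the two degree functions `s` ("`deg S`") and `t` ("`deg T`") and preserving the
weight `w`: for the cut `a = ⌊(2w+2)/3⌋ = ⌈2w/3⌉`,
`2·#{s + t < a} + #{2a ≤ s + t} ≤ 6·#{3t ≤ w ∨ 2w ≤ 3t}`.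
Pigeonhole: `s + t < ⌈2w/3⌉` forces `3s ≤ w ∨ 3t ≤ w`, and `2⌈2w/3⌉ ≤ s + t` forces
`2w ≤ 3s ∨ 2w ≤ 3t`; then `#{S bad ∨ T bad} ≤ #{S bad} + #{T bad}` and `#{S bad} = #{T bad}`
through `e`. [folklore] -/
private theorem two_mul_card_add_card_le {α : Type*} [Finite α] (e : α ≃ α) (s t w a : α → ℤ)
    (ha : ∀ i, a i = (2 * w i + 2) / 3)
    (he : ∀ i, (3 * s i ≤ w i ∨ 2 * w i ≤ 3 * s i) ↔
      (3 * t (e i) ≤ w (e i) ∨ 2 * w (e i) ≤ 3 * t (e i))) :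
    2 * Nat.card {i // s i + t i < a i} + Nat.card {i // 2 * a i ≤ s i + t i} ≤
      6 * Nat.card {i // 3 * t i ≤ w i ∨ 2 * w i ≤ 3 * t i} := by
  classical
  haveI := Fintype.ofFinite α
  have hswap : Fintype.card {i // 3 * s i ≤ w i ∨ 2 * w i ≤ 3 * s i} =
      Fintype.card {i // 3 * t i ≤ w i ∨ 2 * w i ≤ 3 * t i} :=
    Fintype.card_congr (e.subtypeEquiv he)
  have hor : Fintype.card {i // (3 * s i ≤ w i ∨ 2 * w i ≤ 3 * s i) ∨
        (3 * t i ≤ w i ∨ 2 * w i ≤ 3 * t i)} ≤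
      Fintype.card {i // 3 * s i ≤ w i ∨ 2 * w i ≤ 3 * s i} +
        Fintype.card {i // 3 * t i ≤ w i ∨ 2 * w i ≤ 3 * t i} :=
    Fintype.card_subtype_or _ _
  have h1 : Fintype.card {i // s i + t i < a i} ≤
      Fintype.card {i // (3 * s i ≤ w i ∨ 2 * w i ≤ 3 * s i) ∨
        (3 * t i ≤ w i ∨ 2 * w i ≤ 3 * t i)} :=
    Fintype.card_subtype_mono _ _ fun i hi => by have := ha i; omega
  have h2 : Fintype.card {i // 2 * a i ≤ s i + t i} ≤
      Fintype.card {i // (3 * s i ≤ w i ∨ 2 * w i ≤ 3 * s i) ∨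
        (3 * t i ≤ w i ∨ 2 * w i ≤ 3 * t i)} :=
    Fintype.card_subtype_mono _ _ fun i hi => by have := ha i; omega
  simp only [Nat.card_eq_fintype_card]
  omega

/-- Beyond some `n₁`, `6 ≤ e^{(c/2)√n}` (`n₁ = ⌈(2 log 6 / c)²⌉`). [folklore] -/
private theorem exists_six_le_exp {c : ℝ} (hc : 0 < c) :
    ∃ n₁ : ℕ, ∀ n : ℕ, n₁ ≤ n → (6 : ℝ) ≤ Real.exp (c / 2 * Real.sqrt (n : ℝ)) := by
  refine ⟨⌈(2 * Real.log 6 / c) ^ 2⌉₊, fun n hn => ?_⟩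
  have hn' : (2 * Real.log 6 / c) ^ 2 ≤ (n : ℝ) := (Nat.le_ceil _).trans (by exact_mod_cast hn)
  have h0 : 0 ≤ 2 * Real.log 6 / c := by
    have : 0 ≤ Real.log 6 := Real.log_nonneg (by norm_num)
    positivity
  have hsq : 2 * Real.log 6 / c ≤ Real.sqrt (n : ℝ) := by
    rw [← Real.sqrt_sq h0]
    exact Real.sqrt_le_sqrt hn'
  have hlog : Real.log 6 ≤ c / 2 * Real.sqrt (n : ℝ) := by
    have := mul_le_mul_of_nonneg_left hsq (le_of_lt (half_pos hc))
    calc Real.log 6 = c / 2 * (2 * Real.log 6 / c) := by field_simp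
      _ ≤ c / 2 * Real.sqrt (n : ℝ) := this
  calc (6 : ℝ) = Real.exp (Real.log 6) := (Real.exp_log (by norm_num)).symm
    _ ≤ Real.exp (c / 2 * Real.sqrt (n : ℝ)) := Real.exp_le_exp.2 hlog

end KlrLine

set_option linter.dupNamespace false in -- deliberate Summit.<S>.<P> duplicate
open KlrLine in
/-- **Stub `noThresholdSubsetTriple_of_klr_swPairsMDP` (line `klr-graded-polynomial-method`, crux
`SnSubsetDichotomy.NoThresholdSubsetTriple`, stmt-MatrixMultiplication-8302): the whole KLR line
as one conditional theorem.** If `𝔽_p[S_n]` has the Hu–Mathas graded block basis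
(`KLRGradedCellularBasis`, K3) and the boxed signed-pair moderate deviation J′ holds
(`#{(μ, S, T) : μ₁, ℓ(μ) < 3√n, 200·(S⁺(T) − S⁻(T)) ≤ −n} ≤ n!·e^{-c√n}` for large `n`), then
every TPP triple `S, T, U ⊆ S_n` has `|S||T||U| ≤ (n!)^{3/2}·e^{-c'√n}` for large `n`
(`NoThresholdSubsetTriple`). Proof: K2′ = `degreeTailSingle_of_swPairsMDP hJ`; the K2 counting
`2·#{deg S + deg T < ⌈2w/3⌉} + #{2⌈2w/3⌉ ≤ deg S + deg T} ≤ 6·#{T bad}` (pigeonhole and the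
swap involution `(μ, S, T) ↦ (μ, T, S)`); K1 = `stub_gradedCodim` on the K3 basis of `𝔽₂[S_n]`
with the cut `⌈2w/3⌉` gives `slice-rank_{𝔽₂} D_{S_n} ≤ 6·n!e^{-c√n} ≤ n!e^{-(c/2)√n}` once
`6 ≤ e^{(c/2)√n}`; and `stub_savingTransfer` turns this modular slice-rank saving into the
crux. [folklore] -/
theorem noThresholdSubsetTriple_of_klr_swPairsMDP : Literature.RepresentationTheory.FiniteGroups.KLRGradedCellularBasis → (∃ c : ℝ, 0 < c ∧ ∃ n₀ : ℕ, ∀ n ≥ n₀, (Nat.card {i : TableauPair n // (i.1.youngDiagram.rowLen 0 : ℝ) < 3 * Real.sqrt (n : ℝ) ∧ (i.1.youngDiagram.colLen 0 : ℝ) < 3 * Real.sqrt (n : ℝ) ∧ 200 * ((∑ k : Fin n, ∑ j ∈ Finset.univ.filter (fun j : Fin n => j < k ∧ (i.2.2.1 k).1 < (i.2.2.1 j).1 ∧ (i.2.2.1 j).2 < (i.2.2.1 k).2), (-1 : ℤ) ^ ((i.2.2.1 j).1 + (i.2.2.1 j).2 + (i.2.2.1 k).1 + (i.2.2.1 k).2))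 - (∑ k : Fin n, ∑ j ∈ Finset.univ.filter (fun j : Fin n => j < k ∧ (i.2.2.1 j).1 < (i.2.2.1 k).1 ∧ (i.2.2.1 k).2 < (i.2.2.1 j).2), (-1 : ℤ) ^ ((i.2.2.1 j).1 + (i.2.2.1 j).2 + (i.2.2.1 k).1 + (i.2.2.1 k).2))) ≤ -(n : ℤ)} : ℝ) ≤ (n.factorial : ℝ) * Real.exp (-(c * Real.sqrt (n : ℝ)))) → Summit.MatrixMultiplication.MatrixMultiplication.Theses.SnSubsetDichotomy.NoThresholdSubsetTriple := by
  intro hK hJ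
  -- K2′: the one-tableau degree tail, from J′
  obtain ⟨c, hc, n₀, hT⟩ := degreeTailSingle_of_swPairsMDP hJ
  obtain ⟨n₁, hn₁⟩ := exists_six_le_exp hc
  -- the transfer: it suffices to bound `slice-rank_{𝔽₂} D_{S_n}` for `n ≥ max n₀ n₁`
  refine stub_savingTransfer ⟨c / 2, half_pos hc, max n₀ n₁, fun n hn => ⟨2, Nat.prime_two, ?_⟩⟩
  obtain ⟨hn₀, hn₁'⟩ : n₀ ≤ n ∧ n₁ ≤ n := by simpa only [ge_iff_le, max_le_iff] using hn
  -- K3: the graded block basis of `𝔽₂[S_n]`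
  obtain ⟨β, hβ⟩ := hK 2 n
  -- K1 on that basis with the cut `a = ⌈2w/3⌉`, then the K2 counting (swap involution)
  have hN : sliceRank (mulGroupTensor (ZMod 2) (Equiv.Perm (Fin n))) ≤
      6 * Nat.card {i : TableauPair n //
        3 * Literature.RepresentationTheory.FiniteGroups.tableauDegree 2 i.2.2.1 ≤
            (TableauPair.content 2 i 0 : ℤ) -
              ((TableauPair.content 2 i 0 : ℤ) - (TableauPair.content 2 i 1 : ℤ)) ^ 2 ∨
          2 * ((TableauPair.content 2 i 0 : ℤ) -
              ((TableauPair.content 2 i 0 : ℤ) - (TableauPair.content 2 i 1 : ℤ)) ^ 2) ≤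
            3 * Literature.RepresentationTheory.FiniteGroups.tableauDegree 2 i.2.2.1} :=
    (stub_gradedCodim (ZMod 2) (Equiv.Perm (Fin n)) (TableauPair n) (ZMod 2 → ℕ) β
        (TableauPair.degree 2) (TableauPair.content 2) hβ
        (fun κ : ZMod 2 → ℕ => (2 * ((κ 0 : ℤ) - ((κ 0 : ℤ) - (κ 1 : ℤ)) ^ 2) + 2) / 3)).trans
      (two_mul_card_add_card_le
        (Equiv.sigmaCongrRight fun _ => Equiv.prodComm _ _ : TableauPair n ≃ TableauPair n)
        (fun i : TableauPair n => tableauDegree 2 i.2.1.1)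
        (fun i : TableauPair n => tableauDegree 2 i.2.2.1)
        (fun i : TableauPair n => (TableauPair.content 2 i 0 : ℤ) -
          ((TableauPair.content 2 i 0 : ℤ) - (TableauPair.content 2 i 1 : ℤ)) ^ 2)
        (fun i : TableauPair n => (2 * ((TableauPair.content 2 i 0 : ℤ) -
          ((TableauPair.content 2 i 0 : ℤ) - (TableauPair.content 2 i 1 : ℤ)) ^ 2) + 2) / 3)
        (fun _ => rfl) (fun _ => Iff.rfl))
  have hR := Nat.cast_le (α := ℝ) |>.2 hN
  push_cast at hR
  -- constants: `6·n!e^{-c√n} ≤ n!e^{-(c/2)√n}`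
  have hbad := hT n hn₀
  have hf : (0 : ℝ) ≤ (n.factorial : ℝ) * Real.exp (-(c * Real.sqrt (n : ℝ))) := by positivity
  have hEF : 6 * ((n.factorial : ℝ) * Real.exp (-(c * Real.sqrt (n : ℝ)))) ≤
      Real.exp (c / 2 * Real.sqrt (n : ℝ)) * ((n.factorial : ℝ) * Real.exp (-(c * Real.sqrt (n : ℝ)))) :=
    mul_le_mul_of_nonneg_right (hn₁ n hn₁') hf
  have key : Real.exp (c / 2 * Real.sqrt (n : ℝ)) *
        ((n.factorial : ℝ) * Real.exp (-(c * Real.sqrt (n : ℝ)))) =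
      (n.factorial : ℝ) * Real.exp (-(c / 2 * Real.sqrt (n : ℝ))) := by
    rw [mul_left_comm, ← Real.exp_add]
    congr 1
    ring_nf
  linarith [hR, hbad, hEF, key]

end Summit.MatrixMultiplication.MatrixMultiplication.Theorems
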